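import Summits.HubbardSuperconductivity.HubbardSuperconductivity.Theorems.LevyLogBootstrapLevyTransportKernelPositivity
import Summits.HubbardSuperconductivity.HubbardSuperconductivity.Theorems.LevyLogBootstrapLevyTransportBlockSums
import Summits.HubbardSuperconductivity.HubbardSuperconductivity.Theorems.LevyLogBootstrapLevyJensenFloor
import Literature.MathematicalPhysics.QuantumLattice.SpinOperatorsProofs
import HarnessLib

/-!
# Crux `LevyTransport` (stmt-HubbardSuperconductivity-15049, route `LevyLogBootstrap`), line `birth`:
# stub `stub_levyFloor` — condensate fraction `≥ e^{-Lévy mass}` along half-filled ground states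

Registered stub `stub_levyFloor` of the skeleton `Cruxes/LevyTransport/Lines/birth.lean` (the
"Jensen floor" joint of the log-bootstrap line): for every even `M ≥ 4`, every real `Δ` and every
normalised `S^z_tot = 0` sector ground state `ψ` of `H_M(Δ) = xxzHamiltonian 1 (torusGraph 2 M) (-1) Δ`,

  `exp(-levyMass M ψ) / 8 · M⁴ ≤ planarOrder M ψ = Re⟨ψ, S⁺_tot S⁻_tot ψ⟩`,

`levyMass M ψ = M⁻² Σ_x -log(K₂(x,0)/K₂(0,0))`, `K₂` the 2×2-block transverse kernel exactly as in
`Block2InfDivXXZ`. The skeleton's statement abbreviations (`IsHalfFilledGS`, `transverseKernel`,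
`blockKernel`, `levyMass`, `planarOrder`) are LOCAL `def`s of the Cruxes file, which a Theorems file
may not import; this file therefore proves the stub with those abbreviations UNFOLDED verbatim
(`stub_levyFloor_explicit`, registered on the item as the explicit twin), so that in the skeleton
`stub_levyFloor := by exact stub_levyFloor_explicit` (definitional unfolding).

Proof (all at fixed finite `M`; nothing asymptotic; helpers in the sibling files
`…LevyTransportKernelPositivity.lean`, `…LevyTransportBlockSums.lean`):
* `LevyFloor.transverseKernel_pos_all` — Perron–Frobenius positivity `Re⟨ψ, S⁺_x S⁻_y ψ⟩ > 0` for
  EVERY real `Δ` (the landed `stub_transverseKernelPos` of crux `Block2InfDivXXZ` carries the —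
  unused — hypothesis `Δ ∈ [-1,0]`; same proof), so `K₂ > 0` and the logarithms are genuine;
* Jensen: `levyJensenFloor_proof` (item stmt-…-15050, landed) with `k x = K₂(x, 0)`:
  `e^{-|ν|} ≤ (Σ_x K₂(x,0)) / (M² K₂(0,0))`;
* translation covariance of the sector ground-state kernel (`gs_transverseKernel_translate`,
  landed in `…Block2InfDivXXZKernelCovariance.lean`) ⇒ every row sum of `K` is `S = Σ_u K(u,0)`,
  `planarOrder = M² S` (`planarOrder_eq_sum_sum`, `sum_sum_eq`) and, counting four sites per 2×2
  block (`card_filter_block`), `Σ_x K₂(x,0) = 16 S` (`sum_blockKernel_zero`);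
* half filling: `S⁺_x S⁻_x = ½ + Sᶻ_x` (spin ½), `Sᶻ_tot ψ = 0` in the sector and translation
  invariance give `Re⟨ψ, S⁺_x S⁻_x ψ⟩ = ½` (`transverseKernel_diag`), hence `K₂(0,0) ≥ 4·½ = 2`
  (`blockKernel_zero_zero_ge`, off-diagonal terms `≥ 0`);
* so `e^{-|ν|} ≤ 16 S/(2 M²) = 8·planarOrder/M⁴`.

Sources: C. Berg, J. P. R. Christensen, P. Ressel (1984) Ch. 3 (kernels); R. Bhatia, Amer. Math.
Monthly 113 (2006) 221; H. Tasaki (2020) §2.1 (lattice symmetries), §2.4 (Perron–Frobenius in a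
magnetisation sector); T. Kennedy, E. H. Lieb, B. S. Shastry, J. Stat. Phys. 53 (1988) 1019, p. 1021;
route card `levy-mass-log-bootstrap` (P1 "condensate fraction ≥ e^{−Lévy mass}"). No definition is
introduced; sorry-free.
-/

noncomputable section

set_option linter.dupNamespace false

namespace Summit.HubbardSuperconductivity.HubbardSuperconductivity.Theorems.LevyLogBootstrap

open scoped BigOperators Matrix ComplexOrder
open Matrix Finset Complex
open Literature.MathematicalPhysics.QuantumLattice Literature.Probability.LatticeModels
open Summit.AtomisticToContinuum.BoseEinsteinCondensation.Theorems.BECStronglyRayleighSectorPerron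
open Summit.AtomisticToContinuum.BoseEinsteinCondensation.Theorems.InsertionFieldDelocalisation.Negative
open Summit.HubbardSuperconductivity.HubbardSuperconductivity.Theorems.PolyaSchurPairBoson

namespace LevyFloor

/-! ### Model facts for the half-filled sector ground state -/

section Model

variable (M : ℕ) [NeZero M]

/-- For spin ½: `S⁺ S⁻ = ½ + Sᶻ`. Tasaki (2020) §2.1, eq. (2.1.7). [folklore] -/
theorem spinRaise_mul_spinLower_one :
    spinRaise 1 * spinLower 1 = (1 / 2 : ℂ) • (1 : Matrix (Fin 2) (Fin 2) ℂ) + SpinOperators.spinZ 1 := by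
  ext k l
  rw [spinRaise_mul_spinLower_apply, Matrix.add_apply, Matrix.smul_apply, Matrix.one_apply,
    spinZ_apply]
  fin_cases k <;> fin_cases l <;> norm_num

/-- The planar order parameter is the total sum of the transverse kernel:
`Re⟨ψ, S⁺_tot S⁻_tot ψ⟩ = Σ_{x,y} Re⟨ψ, S⁺_x S⁻_y ψ⟩`. [folklore] -/
theorem planarOrder_eq_sum_sum {Λ : Type*} [Fintype Λ] [DecidableEq Λ] (ψ : TensorIndex Λ 2 → ℂ) :
    (star ψ ⬝ᵥ Matrix.mulVec ((∑ x : Λ, onSite x (spinRaise 1)) * (∑ y : Λ, onSite y (spinLower 1))) ψ).re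
      = ∑ x : Λ, ∑ y : Λ,
          (star ψ ⬝ᵥ Matrix.mulVec (onSite x (spinRaise 1) * onSite y (spinLower 1)) ψ).re := by
  rw [Finset.sum_mul_sum, Matrix.sum_mulVec, dotProduct_sum, Complex.re_sum]
  refine Finset.sum_congr rfl fun x _ => ?_
  rw [Matrix.sum_mulVec, dotProduct_sum, Complex.re_sum]

/-- **Half filling: `⟨S⁺_x S⁻_x⟩ = ½` at every site** for a normalised `S^z_tot = 0` sector ground
state (even `M`): `S⁺_x S⁻_x = ½ + Sᶻ_x`, `Σ_x Sᶻ_x ψ = 0` in the sector, and the diagonal of the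
transverse kernel is translation invariant (`gs_transverseKernel_translate`). [folklore] -/
theorem transverseKernel_diag (hEven : Even M) (Δ : ℝ)
    (ψ : TensorIndex (TorusSite 2 M) 2 → ℂ)
    (hψ : ψ ∈ @spinZSector (TorusSite 2 M) _ _ 1 0) (hnorm : star ψ ⬝ᵥ ψ = 1)
    (heig : Matrix.mulVec (xxzHamiltonian 1 (torusGraph 2 M) (-1) Δ) ψ =
      ((lowestEnergyInSector 1 (xxzHamiltonian 1 (torusGraph 2 M) (-1) Δ) 0 : ℝ) : ℂ) • ψ)
    (x : TorusSite 2 M) :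
    (star ψ ⬝ᵥ Matrix.mulVec (onSite x (spinRaise 1) * onSite x (spinLower 1)) ψ).re = 1 / 2 := by
  -- translation invariance of the diagonal
  have hconst : ∀ z : TorusSite 2 M,
      (star ψ ⬝ᵥ Matrix.mulVec (onSite z (spinRaise 1) * onSite z (spinLower 1)) ψ).re =
      (star ψ ⬝ᵥ Matrix.mulVec (onSite 0 (spinRaise 1) * onSite 0 (spinLower 1)) ψ).re := by
    intro z
    have h := gs_transverseKernel_translate M hEven Δ ψ hψ hnorm heig z 0 0
    rwa [zero_add] at h
  -- the diagonal sums to `M²/2`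
  have hop : ∑ z : TorusSite 2 M, (onSite z (spinRaise 1) * onSite z (spinLower 1) : Op (TorusSite 2 M) 2)
      = ((Fintype.card (TorusSite 2 M) : ℂ) * (1 / 2 : ℂ)) • (1 : Op (TorusSite 2 M) 2) +
          totalSpin 1 2 := by
    have hz : ∀ z : TorusSite 2 M, (onSite z (spinRaise 1) * onSite z (spinLower 1) : Op (TorusSite 2 M) 2)
        = (1 / 2 : ℂ) • (1 : Op (TorusSite 2 M) 2) + onSite z (SpinOperators.spinZ 1) := by
      intro z
      rw [onSite_mul, spinRaise_mul_spinLower_one, onSite_add', onSite_smul', onSite_one']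
    simp_rw [hz]
    rw [Finset.sum_add_distrib, Finset.sum_const, Finset.card_univ, LiebMattis.totalSpin_two_eq_sum_onSite,
      ← Nat.cast_smul_eq_nsmul ℂ, smul_smul]
  have hT0 : totalSpin 1 2 *ᵥ ψ = 0 := by
    have h := Module.End.mem_eigenspace_iff.1 hψ
    rw [Matrix.toLin'_apply] at h
    rw [h]
    simp
  have hsum : ∑ z : TorusSite 2 M,
      (star ψ ⬝ᵥ Matrix.mulVec (onSite z (spinRaise 1) * onSite z (spinLower 1)) ψ).re =
      (M : ℝ) ^ 2 / 2 := by
    rw [← Complex.re_sum, ← dotProduct_sum, ← Matrix.sum_mulVec, hop, add_mulVec, hT0, add_zero,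
      smul_mulVec, one_mulVec, dotProduct_smul, hnorm, smul_eq_mul, mul_one, card_torusSite]
    have key : ∀ w : ℂ, w = (((M : ℝ) ^ 2 / 2 : ℝ) : ℂ) → w.re = (M : ℝ) ^ 2 / 2 := by
      rintro w rfl
      exact Complex.ofReal_re _
    apply key
    push_cast
    ring
  simp_rw [hconst] at hsum
  rw [Finset.sum_const, Finset.card_univ, card_torusSite, nsmul_eq_mul] at hsum
  push_cast at hsum
  rw [hconst x]
  have hM0 : (0 : ℝ) < (M : ℝ) ^ 2 := by
    have : (0 : ℝ) < (M : ℝ) := by exact_mod_cast Nat.pos_of_ne_zero (NeZero.ne M)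
    positivity
  field_simp at hsum
  nlinarith [hsum, hM0]

end Model

end LevyFloor

open LevyFloor in
/-- **Registered-stub form of `stub_levyFloor` (crux `LevyTransport`, line `birth`), fully
unfolded** — the skeleton's abbreviations `IsHalfFilledGS`, `blockKernel`, `levyMass`,
`planarOrder` (local `def`s of `Cruxes/LevyTransport/Lines/birth.lean`) written out, so that the
skeleton's `stub_levyFloor` is this theorem by `exact` (definitional unfolding). CONDENSATE
FRACTION `≥ e^{-LÉVY MASS}` ALONG GROUND STATES: for every even `M ≥ 4`, every real `Δ` and every
normalised `S^z_tot = 0` sector ground state `ψ` of `H_M(Δ) = xxzHamiltonian 1 (torusGraph 2 M) (-1) Δ`,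
`exp(-|ν|(ψ))/8 · M⁴ ≤ Re⟨ψ, S⁺_tot S⁻_tot ψ⟩`, where `|ν|(ψ) = M⁻² Σ_x -log(K₂(x,0)/K₂(0,0))` is
the Lévy mass of the 2×2-block transverse kernel `K₂`. Proof: `K₂ > 0` (Perron–Frobenius,
`transverseKernel_pos_all`); Jensen (`levyJensenFloor_proof`, item 15050) gives
`e^{-|ν|} ≤ (Σ_x K₂(x,0))/(M² K₂(0,0))`; translation covariance of the sector ground-state kernel
(`gs_transverseKernel_translate`) gives `Σ_x K₂(x,0) = 16·Re⟨S⁺_totS⁻_tot⟩/M²`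
(`sum_blockKernel_zero`, `sum_sum_eq`, `planarOrder_eq_sum_sum`) and, with `⟨S⁺_xS⁻_x⟩ = ½` at
half filling (`transverseKernel_diag`), `K₂(0,0) ≥ 2` (`blockKernel_zero_zero_ge`).
Berg–Christensen–Ressel (1984) Ch. 3; Tasaki (2020) §2.4; card `levy-mass-log-bootstrap` (P1).
[folklore] -/
theorem stub_levyFloor_explicit :
    ∀ (M : ℕ) [NeZero M], Even M → 4 ≤ M → ∀ (Δ : ℝ) (ψ : TensorIndex (TorusSite 2 M) 2 → ℂ),
      (ψ ∈ @spinZSector (TorusSite 2 M) _ _ 1 0 ∧ star ψ ⬝ᵥ ψ = 1 ∧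
        Matrix.mulVec (xxzHamiltonian 1 (torusGraph 2 M) (-1) Δ) ψ =
          ((lowestEnergyInSector 1 (xxzHamiltonian 1 (torusGraph 2 M) (-1) Δ) 0 : ℝ) : ℂ) • ψ) →
      Real.exp (-((∑ x : TorusSite 2 M, -Real.log (
          (∑ x' : TorusSite 2 M, ∑ y' : TorusSite 2 M,
            if (∀ i : Fin 2, (x' i).val / 2 = (x i).val / 2) ∧
                (∀ i : Fin 2, (y' i).val / 2 = ((0 : TorusSite 2 M) i).val / 2) then
              (star ψ ⬝ᵥ Matrix.mulVec (onSite x' (spinRaise 1) * onSite y' (spinLower 1)) ψ).re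
            else 0) /
          (∑ x' : TorusSite 2 M, ∑ y' : TorusSite 2 M,
            if (∀ i : Fin 2, (x' i).val / 2 = ((0 : TorusSite 2 M) i).val / 2) ∧
                (∀ i : Fin 2, (y' i).val / 2 = ((0 : TorusSite 2 M) i).val / 2) then
              (star ψ ⬝ᵥ Matrix.mulVec (onSite x' (spinRaise 1) * onSite y' (spinLower 1)) ψ).re
            else 0))) / (M : ℝ) ^ 2)) / 8 * (M : ℝ) ^ 4 ≤
      (star ψ ⬝ᵥ Matrix.mulVec ((∑ x : TorusSite 2 M, onSite x (spinRaise 1)) *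
        (∑ y : TorusSite 2 M, onSite y (spinLower 1))) ψ).re := by
  intro M _ hM h4 Δ ψ hgs
  obtain ⟨hψ, hnorm, heig⟩ := hgs
  -- fold the goal over the kernel `K`, the block kernel `k = K₂(·, 0)` and the planar order `P`
  set K : TorusSite 2 M → TorusSite 2 M → ℝ := fun x y =>
    (star ψ ⬝ᵥ Matrix.mulVec (onSite x (spinRaise 1) * onSite y (spinLower 1)) ψ).re with hKdef
  set k : TorusSite 2 M → ℝ := fun x => ∑ x' : TorusSite 2 M, ∑ y' : TorusSite 2 M,
      if (∀ i : Fin 2, (x' i).val / 2 = (x i).val / 2) ∧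
          (∀ i : Fin 2, (y' i).val / 2 = ((0 : TorusSite 2 M) i).val / 2) then K x' y' else 0
    with hkdef
  set P : ℝ := (star ψ ⬝ᵥ Matrix.mulVec ((∑ x : TorusSite 2 M, onSite x (spinRaise 1)) *
        (∑ y : TorusSite 2 M, onSite y (spinLower 1))) ψ).re with hPdef
  change Real.exp (-((∑ x : TorusSite 2 M, -Real.log (k x / k 0)) / (M : ℝ) ^ 2)) / 8 *
      (M : ℝ) ^ 4 ≤ P
  -- the model inputs
  have hKpos : ∀ x y, 0 < K x y := fun x y =>
    transverseKernel_pos_all M hM h4 Δ ψ hψ hnorm heig x y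
  have hT : ∀ v x y : TorusSite 2 M, K (x + v) (y + v) = K x y := fun v x y =>
    gs_transverseKernel_translate M hM Δ ψ hψ hnorm heig v x y
  have hdiag : ∀ x, K x x = 1 / 2 := fun x => transverseKernel_diag M hM Δ ψ hψ hnorm heig x
  have hP : P = (M : ℝ) ^ 2 * ∑ u : TorusSite 2 M, K u 0 := by
    rw [hPdef, planarOrder_eq_sum_sum]
    exact sum_sum_eq K hT
  -- the block kernel `k = K₂(·, 0)` is positive
  have hterm : ∀ x x' y' : TorusSite 2 M, 0 ≤
      (if (∀ i : Fin 2, (x' i).val / 2 = (x i).val / 2) ∧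
          (∀ i : Fin 2, (y' i).val / 2 = ((0 : TorusSite 2 M) i).val / 2) then K x' y' else 0) := by
    intro x x' y'
    split_ifs
    · exact (hKpos x' y').le
    · exact le_rfl
  have hkpos : ∀ x, 0 < k x := by
    intro x
    refine Finset.sum_pos' (fun x' _ => Finset.sum_nonneg fun y' _ => hterm x x' y')
      ⟨x, Finset.mem_univ _, ?_⟩
    refine Finset.sum_pos' (fun y' _ => hterm x x y') ⟨0, Finset.mem_univ _, ?_⟩
    rw [if_pos ⟨fun _ => rfl, fun _ => rfl⟩]
    exact hKpos x 0
  -- Jensen (item 15050), block row sum, diagonal block bound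
  have hJ := levyJensenFloor_proof M k hkpos
  have hsumk : ∑ x, k x = 16 * ∑ u : TorusSite 2 M, K u 0 := sum_blockKernel_zero K hM hT
  have hk0 : 4 * (1 / 2 : ℝ) ≤ k 0 :=
    blockKernel_zero_zero_ge K hM (fun x y => (hKpos x y).le) hdiag
  -- from here on only real arithmetic: forget the definitions
  clear_value K k P
  have hlog : (∑ x : TorusSite 2 M, -Real.log (k x / k 0)) = ∑ x, Real.log (k 0 / k x) := by
    refine Finset.sum_congr rfl fun x _ => ?_
    rw [← Real.log_inv, inv_div]
  set S : ℝ := ∑ u : TorusSite 2 M, K u 0 with hS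
  have hM2 : (0 : ℝ) < (M : ℝ) ^ 2 := by
    have : (0 : ℝ) < (M : ℝ) := by exact_mod_cast Nat.pos_of_ne_zero (NeZero.ne M)
    positivity
  have hSpos : 0 < S := Finset.sum_pos (fun u _ => hKpos u 0) Finset.univ_nonempty
  have h1 : Real.exp (-((∑ x : TorusSite 2 M, -Real.log (k x / k 0)) / (M : ℝ) ^ 2)) ≤
      16 * S / ((M : ℝ) ^ 2 * k 0) := by
    rw [hlog, ← neg_div, ← hsumk]
    exact hJ
  have h2 : 16 * S / ((M : ℝ) ^ 2 * k 0) ≤ 8 * S / (M : ℝ) ^ 2 := by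
    rw [div_le_div_iff₀ (by positivity) hM2]
    nlinarith [hk0, hSpos.le, hM2.le, mul_nonneg hSpos.le hM2.le]
  have h3 : Real.exp (-((∑ x : TorusSite 2 M, -Real.log (k x / k 0)) / (M : ℝ) ^ 2)) ≤
      8 * S / (M : ℝ) ^ 2 := h1.trans h2
  have h4' : (8 * S / (M : ℝ) ^ 2) / 8 * (M : ℝ) ^ 4 = (M : ℝ) ^ 2 * S := by
    field_simp
  have hM4 : (0 : ℝ) ≤ (M : ℝ) ^ 4 := by positivity
  calc Real.exp (-((∑ x : TorusSite 2 M, -Real.log (k x / k 0)) / (M : ℝ) ^ 2)) / 8 * (M : ℝ) ^ 4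
      ≤ (8 * S / (M : ℝ) ^ 2) / 8 * (M : ℝ) ^ 4 :=
        mul_le_mul_of_nonneg_right (div_le_div_of_nonneg_right h3 (by norm_num)) hM4
    _ = (M : ℝ) ^ 2 * S := h4'
    _ = P := hP.symm

end Summit.HubbardSuperconductivity.HubbardSuperconductivity.Theorems.LevyLogBootstrap

end
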